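import Summits.ValiantsHypothesis.ValiantsHypothesis.Theorems.SymPencilSdcPerFourWindowTwentySeven
import Summits.ValiantsHypothesis.ValiantsHypothesis.Theorems.SymPencilBasePointDetConst
import Summits.ValiantsHypothesis.ValiantsHypothesis.Theorems.SymPencilPerFourPeeledTenHR2
import Summits.ValiantsHypothesis.ValiantsHypothesis.Theorems.SymPencilPerFourInnerRankHypMain
import Summits.ValiantsHypothesis.ValiantsHypothesis.Theorems.SymPencilSdcPerFourCellTenSixClosed
import Summits.ValiantsHypothesis.ValiantsHypothesis.Theorems.SymPencilSingFiveClassification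
import Summits.ValiantsHypothesis.ValiantsHypothesis.Theorems.SymPencilSdcPerFourCellTwelveFourClosed
import Summits.ValiantsHypothesis.ValiantsHypothesis.Theorems.SymPencilSdcPerFourCellThirteenThreeToric

/-!
# Route `SymPencil` — `28 ≤ sdc(per_4) ≤ 29`, UNCONDITIONAL: the size-27 table assembled
# (`--supports` stmt-ValiantsHypothesis-5674 `SdcSuperquadratic`; rung currency only — nothing
# here bears on `VP ≠ VNP`)

Assembly, in the pattern of `…SdcPerFourTwentySeven` / `…WindowTwentySeven`, of the six cells of
the size-`27` kernel-package table.  In the base-point package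
(`…BasePointPackage.basepoint_package_of_isSymm_isAffineDetRepr_perPoly_four`) of a symmetric
affine determinantal representation of `per_4` of size `m ≤ 27` the rank `r = dim (im bL)`
satisfies `8 ≤ r ≤ 13` (`2r ≤ m - 1`, `dim ker ≤ 8`), and every value is excluded by a landed
cell theorem:

* `r = 8`:  `…PeeledTenHR2.false_of_rank_eight_le_twentySeven` (inner rank of the `2 | 2` split
  `≥ 11`: P1 `…PureGramP1` + the peeled case `…PeeledTen` via `…InnerRankOfPeeled`);
* `r = 9`:  `…InnerRankHypMain.false_of_rank_nine_le_twentySeven`;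
* `r = 10`: `…CellTenSixClosed.false_of_rank_ten_le_twentySeven` (`IsAlgClosed`);
* `r = 11`: `…SingFiveClassification.false_of_rank_eleven_le_twentySeven`;
* `r = 12`: `…CellTwelveFourClosed.false_of_rank_twelve_le_twentySeven` (`IsAlgClosed`);
* `r = 13`: `…CellThirteenThreeToric.false_of_rank_thirteen_le_twentySeven` (`IsAlgClosed`).

Hence `28 ≤ m` over an algebraically closed field of characteristic `0`
(`twentyEight_le_of_isAlgClosed`), and over ANY field of characteristic `0` by the descent
`…BasePointDetConst.le_size_of_algebraicClosure` (`twentyEight_le_of_isSymm_isAffineDetRepr_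
perPoly_four`).  With the `29 × 29` pencil of `…SdcPerFourTwentyNine`:
**`28 ≤ sdc(per₄) ≤ 29`** (`sdc_perPoly_four_window_twentyEight`); the one open size is `28`.

Honest framing: an `n = 4` calibration value for the aside item `SdcSuperquadratic` (which asks
for a superquadratic lower bound in `n` and stays OPEN); `VP ≠ VNP` is not moved; no summit
statement is proved here.  Credit: the six cells are the work of the val-width / val-lit cell
lanes named in the files above; this file only composes them.  No definitions, no named facts.
[folklore]
-/

noncomputable section

-- single-conjunct layout: Sub = Summit, duplicated namespace component intended
set_option linter.dupNamespace false

namespace Summit.ValiantsHypothesis.ValiantsHypothesis.Theorems.SymPencilSdcPerFourTwentyEight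

open Matrix MvPolynomial Module
open Literature.Computability.AlgebraicComplexity
open Summit.ValiantsHypothesis.ValiantsHypothesis.Theorems.SymPencilPerFourBasePointPackage
open Summit.ValiantsHypothesis.ValiantsHypothesis.Theorems.SymPencilBasePointDetConst

/-- **Every symmetric affine determinantal representation of `per_4` over an algebraically closed
field of characteristic `0` has size `≥ 28`** — the six cells of the size-`27` table. [folklore] -/
theorem twentyEight_le_of_isAlgClosed (K : Type*) [Field K] [CharZero K] [IsAlgClosed K]
    {m : ℕ} {A : Matrix (Fin m) (Fin m) (MvPolynomial (Fin 4 × Fin 4) K)}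
    (hS : A.IsSymm) (hA : IsAffineDetRepr (perPoly (Fin 4) K) A) : 28 ≤ m := by
  classical
  by_contra hlt
  have hm : m ≤ 27 := by omega
  obtain ⟨i₀, D, bL, CL, κ, hD, hDs, hCs, hκ, hi, hii, hiii, hV4, hcard, hranle, hrn, hkerle,
    hN⟩ := basepoint_package_of_isSymm_isAffineDetRepr_perPoly_four K hS hA
  have hr : finrank K (LinearMap.range bL) = 8 ∨ finrank K (LinearMap.range bL) = 9 ∨
      finrank K (LinearMap.range bL) = 10 ∨ finrank K (LinearMap.range bL) = 11 ∨
      finrank K (LinearMap.range bL) = 12 ∨ finrank K (LinearMap.range bL) = 13 := by omega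
  rcases hr with h8 | h9 | h10 | h11 | h12 | h13
  · exact SymPencilPerFourPeeledTenHR2.false_of_rank_eight_le_twentySeven K hm hD hDs hCs hκ hi
      hii hiii hV4 hcard hrn h8
  · exact SymPencilPerFourInnerRankHypMain.false_of_rank_nine_le_twentySeven K hm hD hDs hCs hκ
      hi hii hiii hV4 hcard hrn h9
  · exact SymPencilSdcPerFourCellTenSixClosed.false_of_rank_ten_le_twentySeven K hm hD hDs hCs hκ
      hi hii hiii hV4 hcard hrn hN h10
  · exact SymPencilSingFiveClassification.false_of_rank_eleven_le_twentySeven K hm hD hDs hCs hκ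
      hi hii hiii hV4 hcard hranle hrn hN h11
  · exact SymPencilSdcPerFourCellTwelveFourClosed.false_of_rank_twelve_le_twentySeven (K := K) hm
      hD hDs hCs hκ hi hii hiii hcard hrn hN h12
  · exact SymPencilSdcPerFourCellThirteenThreeToric.false_of_rank_thirteen_le_twentySeven K hm hD
      hDs hCs hκ hi hii hiii hcard hranle hrn hN h13

/-- **Every symmetric affine determinantal representation of `per_4` over a field of
characteristic `0` has size `≥ 28`** (descent from the algebraic closure). [folklore] -/
theorem twentyEight_le_of_isSymm_isAffineDetRepr_perPoly_four (K : Type*) [Field K] [CharZero K]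
    {m : ℕ} {A : Matrix (Fin m) (Fin m) (MvPolynomial (Fin 4 × Fin 4) K)}
    (hS : A.IsSymm) (hA : IsAffineDetRepr (perPoly (Fin 4) K) A) : 28 ≤ m :=
  le_size_of_algebraicClosure
    (fun _ _ hS' hA' => twentyEight_le_of_isAlgClosed (AlgebraicClosure K) hS' hA') hS hA

/-- **No symmetric affine determinantal representation of `per_4` has size `≤ 27`**
(characteristic `0`). [folklore] -/
theorem false_of_isSymm_isAffineDetRepr_perPoly_four_le_twentySeven (K : Type*) [Field K]
    [CharZero K] {m : ℕ} (hm : m ≤ 27)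
    {A : Matrix (Fin m) (Fin m) (MvPolynomial (Fin 4 × Fin 4) K)}
    (hS : A.IsSymm) (hA : IsAffineDetRepr (perPoly (Fin 4) K) A) : False := by
  have h := twentyEight_le_of_isSymm_isAffineDetRepr_perPoly_four K hS hA
  omega

/-- **The window `28 ≤ sdc(per₄) ≤ 29`** over any field of characteristic `0`. [folklore] -/
theorem sdc_perPoly_four_window_twentyEight (K : Type*) [Field K] [CharZero K] :
    28 ≤ symmDeterminantalComplexity (perPoly (Fin 4) K) ∧
      symmDeterminantalComplexity (perPoly (Fin 4) K) ≤ 29 := by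
  refine ⟨?_, SymPencilSdcPerFourTwentyNine.sdc_perPoly_four_le_twentyNine K two_ne_zero⟩
  letI : Invertible (2 : K) := invertibleOfNonzero two_ne_zero
  obtain ⟨A, hS, hA⟩ :=
    hasSymmDetRepr_symmDeterminantalComplexity
      ⟨_, SymPencilSdcPerThreeWindow.hasSymmDetRepr_perPoly_quarez K 4⟩
  exact twentyEight_le_of_isSymm_isAffineDetRepr_perPoly_four K hS hA

/-- The complex instance: `28 ≤ sdc(per₄) ≤ 29` over `ℂ`. [folklore] -/
theorem sdc_perPoly_four_window_twentyEight_complex :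
    28 ≤ symmDeterminantalComplexity (perPoly (Fin 4) ℂ) ∧
      symmDeterminantalComplexity (perPoly (Fin 4) ℂ) ≤ 29 :=
  sdc_perPoly_four_window_twentyEight ℂ

end Summit.ValiantsHypothesis.ValiantsHypothesis.Theorems.SymPencilSdcPerFourTwentyEight

end
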